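import Summits.AtomisticToContinuum.Crystallization.Theorems.ExcessDecayLiouvilleFluxPairingFar

/-!
# Route `ExcessDecayLiouville`: the flux pairing, far field through square sums (nonlinear half, IV″)

Harmonic-replacement architecture for item `ExcessDecay` (stmt-AtomisticToContinuum-9334), nonlinear half.
A second decay-aware form of the far pairs of the flux pairing (compare `flux_pairing_le'` of
`ExcessDecayLiouvilleFluxPairingFar.lean`): every far term is estimated by Cauchy–Schwarz over the PAIRS, so
that the test field enters only through `‖w‖_{ℓ²}` and the flux field through its `ℓ²` mass on the ball and
through the double far sum `Θ₂ = Σ_{p ∈ ball} Σ_{q far} (dist p q)⁻⁸ ‖vt q‖²` (`flux_pairing_le''`):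

`ΣΣ ‖Φ‖‖Dw‖ ≤ 2Λ (4·10⁶ √NN[vt] √nnForm(w) + (3 F₈(L) √E_B(vt) + √F₈(L) √Θ₂) ‖w‖_{ℓ²(SR)})`.

This keeps the full `L⁻⁵` decay of the far field, which the excess-decay iteration needs at small scales.
Also `sum_mul_le_sqrt_mul_sqrt` (finite Cauchy–Schwarz).  All `[folklore]`; helper lemmas, nothing here
closes an item.
-/

noncomputable section

namespace Summit.AtomisticToContinuum.Crystallization.Theorems.ExcessDecayLiouville

open scoped BigOperators Topology InnerProductSpace RealInnerProductSpace Classical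
open Literature.MathematicalPhysics.StatisticalMechanics
open Summit.AtomisticToContinuum.Crystallization.Theorems.PhononStabilityNegative

section

variable {t : Fin 2 → (EuclideanSpace ℝ (Fin 3))} {A : (EuclideanSpace ℝ (Fin 3)) →L[ℝ] (EuclideanSpace ℝ (Fin 3))}

variable (hA : Adm₀ A) (hI : Inner₀ t A)

set_option quotPrecheck false in
-- Local notation: the finite near-neighbour form on the ball of radius `X` about `c`.
local notation "NN[" v ", " c ", " X "]" =>
  (∑ p ∈ (finite_sites_dist_le (t := t) (A := A) hA hI c X).toFinset,
    ∑ q ∈ (finite_sites_dist_le (t := t) (A := A) hA hI c X).toFinset,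
      (if p ≠ q ∧ dist p q ≤ 11 / 10 then ‖v p - v q‖ ^ 2 else (0 : ℝ)))

omit hA hI in
/-- Finite Cauchy–Schwarz: `Σ a b ≤ √(Σ a²) √(Σ b²)`. [folklore] -/
theorem sum_mul_le_sqrt_mul_sqrt {γ : Type*} (s : Finset γ) (a b : γ → ℝ) :
    ∑ x ∈ s, a x * b x ≤ Real.sqrt (∑ x ∈ s, a x ^ 2) * Real.sqrt (∑ x ∈ s, b x ^ 2) := by
  have h := Finset.sum_mul_sq_le_sq_mul_sq s a b
  rw [← Real.sqrt_mul (Finset.sum_nonneg fun x _ => sq_nonneg (a x))]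
  exact (le_abs_self _).trans (Real.abs_le_sqrt h)

include hA hI in
/-- **The flux pairing against a localised test field, far field through square sums**: for an antisymmetric
flux `‖Φ p q‖ ≤ Λ (dist p q)⁻⁸ ‖vt p − vt q‖` on `SR`, a test field `w` supported on the sites of `B_{ρ'}(c₀)`,
and the double far sum `Σ_{p ∈ SR ∩ B_{ρ'}} Σ_{q ∈ SR, dist p q > L} (dist p q)⁻⁸ ‖vt q‖² ≤ Θ₂`,
`ΣΣ ‖Φ‖‖Dw‖ ≤ 2Λ (4·10⁶ √NN[vt, ρ'+10L+20] √nnForm(w) + (3F₈(L) √(Σ_{SR∩B} ‖vt‖²) + √F₈(L) √Θ₂) √(Σ_{SR} ‖w‖²))`.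
[folklore] -/
theorem flux_pairing_le'' {w vt : (EuclideanSpace ℝ (Fin 3)) → (EuclideanSpace ℝ (Fin 3))} (hw : (Function.support w).Finite)
    (SR : Finset (EuclideanSpace ℝ (Fin 3))) (hSRS : ∀ x ∈ SR, x ∈ Sites₀ t A)
    {c₀ : EuclideanSpace ℝ (Fin 3)} {ρ' : ℝ} (hwB : ∀ x, w x ≠ 0 → x ∈ SR ∧ dist x c₀ ≤ ρ')
    (Φ : (EuclideanSpace ℝ (Fin 3)) → (EuclideanSpace ℝ (Fin 3)) → (EuclideanSpace ℝ (Fin 3)))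
    (hanti : ∀ p ∈ SR, ∀ q ∈ SR, Φ q p = -Φ p q) {Λ Θ₂ L : ℝ} (hΛ : 0 ≤ Λ) (hL : 1 ≤ L)
    (hΦ : ∀ p ∈ SR, ∀ q ∈ SR, p ≠ q → ‖Φ p q‖ ≤ Λ * (dist p q)⁻¹ ^ 8 * ‖vt p - vt q‖)
    (hΘ : ∑ p ∈ SR.filter (fun p => dist p c₀ ≤ ρ'),
      ∑ q ∈ (SR.erase p).filter (fun q => ¬ dist p q ≤ L), (dist p q)⁻¹ ^ 8 * ‖vt q‖ ^ 2 ≤ Θ₂) :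
    ∑ p ∈ SR, ∑ q ∈ SR.erase p, ‖Φ p q‖ * ‖w p - w q‖ ≤
      2 * Λ * (4000000 * Real.sqrt (NN[vt, c₀, ρ' + 10 * L + 20]) * Real.sqrt (nnForm t A w) +
        (3 * (1024 / ((23 / 25 : ℝ) ^ 3 * L ^ 5)) * Real.sqrt (∑ x ∈ SR.filter (fun p => dist p c₀ ≤ ρ'), ‖vt x‖ ^ 2) +
          Real.sqrt (1024 / ((23 / 25 : ℝ) ^ 3 * L ^ 5)) * Real.sqrt Θ₂) * Real.sqrt (∑ x ∈ SR, ‖w x‖ ^ 2)) := by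
  classical
  set B := SR.filter (fun p => dist p c₀ ≤ ρ') with hB
  have hBT : B ⊆ SR := Finset.filter_subset _ _
  have hwB' : ∀ x, x ∉ B → w x = 0 := by
    intro x hx; by_contra h; exact hx (by rw [hB, Finset.mem_filter]; exact hwB x h)
  -- (1) reduce to the rows of `B`
  have hred := sum_pairs_le_two_mul_rows SR B hBT (fun p q => ‖Φ p q‖ * ‖w p - w q‖)
    (fun p hp q hq => by
      show ‖Φ p q‖ * ‖w p - w q‖ = ‖Φ q p‖ * ‖w q - w p‖
      rw [hanti p hp q hq, norm_neg, norm_sub_rev])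
    (fun p q => by positivity)
    (fun p hp q hq hpB hqB => by simp [hwB' p hpB, hwB' q hqB])
  refine hred.trans ?_
  rw [mul_assoc (2 : ℝ) Λ]
  refine mul_le_mul_of_nonneg_left ?_ (by norm_num)
  -- (2) bound the rows: split each row into near and far pairs
  have hrow : ∀ p ∈ B, ∑ q ∈ SR.erase p, ‖Φ p q‖ * ‖w p - w q‖ ≤
      Λ * (∑ q ∈ (SR.erase p).filter (fun q => dist p q ≤ L), (dist p q)⁻¹ ^ 8 * ‖vt p - vt q‖ * ‖w p - w q‖) +
      Λ * (∑ q ∈ (SR.erase p).filter (fun q => ¬ dist p q ≤ L),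
        (dist p q)⁻¹ ^ 8 * ((‖vt p‖ * ‖w p‖ + ‖vt q‖ * ‖w q‖) + (‖w p‖ * ‖vt q‖ + ‖vt p‖ * ‖w q‖))) := by
    intro p hp
    have hpS := hBT hp
    rw [← Finset.sum_filter_add_sum_filter_not (SR.erase p) (fun q => dist p q ≤ L), Finset.mul_sum, Finset.mul_sum]
    refine add_le_add (Finset.sum_le_sum fun q hq => ?_) (Finset.sum_le_sum fun q hq => ?_)
    · obtain ⟨hq, -⟩ := Finset.mem_filter.1 hq
      obtain ⟨hne, hqS⟩ := Finset.mem_erase.1 hq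
      have := hΦ p hpS q hqS (Ne.symm hne)
      calc ‖Φ p q‖ * ‖w p - w q‖ ≤ (Λ * (dist p q)⁻¹ ^ 8 * ‖vt p - vt q‖) * ‖w p - w q‖ :=
            mul_le_mul_of_nonneg_right this (norm_nonneg _)
        _ = Λ * ((dist p q)⁻¹ ^ 8 * ‖vt p - vt q‖ * ‖w p - w q‖) := by ring
    · obtain ⟨hq, -⟩ := Finset.mem_filter.1 hq
      obtain ⟨hne, hqS⟩ := Finset.mem_erase.1 hq
      have h1 := hΦ p hpS q hqS (Ne.symm hne)
      have h2 : ‖vt p - vt q‖ ≤ ‖vt p‖ + ‖vt q‖ := norm_sub_le _ _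
      have h3 : ‖w p - w q‖ ≤ ‖w p‖ + ‖w q‖ := norm_sub_le _ _
      have h4 : 0 ≤ (dist p q)⁻¹ ^ 8 := by positivity
      calc ‖Φ p q‖ * ‖w p - w q‖ ≤ (Λ * (dist p q)⁻¹ ^ 8 * ‖vt p - vt q‖) * (‖w p‖ + ‖w q‖) :=
            mul_le_mul h1 h3 (norm_nonneg _) (by positivity)
        _ ≤ (Λ * (dist p q)⁻¹ ^ 8 * (‖vt p‖ + ‖vt q‖)) * (‖w p‖ + ‖w q‖) := by gcongr
        _ = Λ * ((dist p q)⁻¹ ^ 8 * ((‖vt p‖ * ‖w p‖ + ‖vt q‖ * ‖w q‖) + (‖w p‖ * ‖vt q‖ + ‖vt p‖ * ‖w q‖))) := by ring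
  refine (Finset.sum_le_sum hrow).trans ?_
  rw [Finset.sum_add_distrib, ← Finset.mul_sum, ← Finset.mul_sum, ← mul_add]
  refine mul_le_mul_of_nonneg_left ?_ hΛ
  refine add_le_add ?_ ?_
  · -- (3) the near pairs: Cauchy–Schwarz and the localised long-range estimate, twice
    have hCS := sum_sum_weight_mul_le B (fun p => (SR.erase p).filter (fun q => dist p q ≤ L))
      (ω := fun p q => (dist p q)⁻¹ ^ 8) (a := fun p q => ‖vt p - vt q‖) (b := fun p q => ‖w p - w q‖)
      (fun p q => by positivity) (fun p q => norm_nonneg _) (fun p q => norm_nonneg _)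
    refine hCS.trans ?_
    have hsub1 : B ⊆ (finite_sites_dist_le (t := t) (A := A) hA hI c₀ ρ').toFinset := by
      intro p hp
      rw [hB, Finset.mem_filter] at hp
      exact (Set.Finite.mem_toFinset _).2 ⟨hSRS p hp.1, hp.2⟩
    have hsub2 : ∀ p ∈ B, (SR.erase p).filter (fun q => dist p q ≤ L) ⊆
        (finite_sites_dist_le (t := t) (A := A) hA hI c₀ (ρ' + L)).toFinset := by
      intro p hp q hq
      rw [hB, Finset.mem_filter] at hp
      obtain ⟨hq, hqL⟩ := Finset.mem_filter.1 hq
      refine (Set.Finite.mem_toFinset _).2 ⟨hSRS q (Finset.mem_erase.1 hq).2, ?_⟩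
      have := dist_triangle q p c₀
      rw [dist_comm q p] at this
      linarith
    have hLR : ∀ (f : (EuclideanSpace ℝ (Fin 3)) → (EuclideanSpace ℝ (Fin 3))),
        ∑ p ∈ B, ∑ q ∈ (SR.erase p).filter (fun q => dist p q ≤ L), (dist p q)⁻¹ ^ 8 * ‖f p - f q‖ ^ 2 ≤
          4000000 * NN[f, c₀, ρ' + 10 * L + 20] := by
      intro f
      refine le_trans ?_ (longRange_local_le hA hI f c₀ (R := ρ') hL)
      refine le_trans (Finset.sum_le_sum fun p hp => ?_)
        (Finset.sum_le_sum_of_subset_of_nonneg hsub1 fun p _ _ => Finset.sum_nonneg fun q _ => by positivity)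
      refine le_trans (Finset.sum_le_sum fun q hq => ?_)
        (Finset.sum_le_sum_of_subset_of_nonneg (hsub2 p hp) fun q _ _ => by positivity)
      obtain ⟨hq, hqL⟩ := Finset.mem_filter.1 hq
      rw [if_pos ⟨Ne.symm (Finset.mem_erase.1 hq).1, hqL⟩]
    have h1 := hLR vt
    have h2 := (hLR w).trans (mul_le_mul_of_nonneg_left (NN_le_nnForm hA hI hw c₀ _) (by norm_num))
    have hs1 := Real.sqrt_le_sqrt h1
    have hs2 := Real.sqrt_le_sqrt h2
    rw [Real.sqrt_mul (by norm_num), show Real.sqrt (4000000 : ℝ) = 2000 by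
      rw [show (4000000 : ℝ) = 2000 ^ 2 by norm_num, Real.sqrt_sq (by norm_num)]] at hs1 hs2
    calc _ ≤ (2000 * Real.sqrt (NN[vt, c₀, ρ' + 10 * L + 20])) * (2000 * Real.sqrt (nnForm t A w)) :=
          mul_le_mul hs1 hs2 (Real.sqrt_nonneg _) (by positivity)
      _ = 4000000 * Real.sqrt (NN[vt, c₀, ρ' + 10 * L + 20]) * Real.sqrt (nnForm t A w) := by ring
  · -- (4) the far pairs, through the values of `vt`
    have hL0 : 23 / 25 ≤ L := by linarith
    have hfar : ∀ p ∈ SR, ∑ q ∈ (SR.erase p).filter (fun q => ¬ dist p q ≤ L), (dist p q)⁻¹ ^ 8 ≤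
        1024 / ((23 / 25 : ℝ) ^ 3 * L ^ 5) := by
      intro p hp
      obtain ⟨hs, hle⟩ := summable_far_inv_pow_eight_sites hA hI p hL0
      refine le_trans ?_ hle
      have hmem : ∀ x ∈ (SR.erase p).filter (fun q => ¬ dist p q ≤ L), x ∈ Sites₀ t A := fun x hx =>
        hSRS x (Finset.mem_erase.1 (Finset.mem_filter.1 hx).1).2
      rw [← Finset.sum_subtype_of_mem (f := fun q => (dist p q)⁻¹ ^ 8) hmem]
      refine le_trans (Finset.sum_le_sum fun q hq => ?_) (hs.sum_le_tsum _ fun q _ => by positivity)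
      have hq' := (Finset.mem_subtype.1 hq)
      obtain ⟨-, hqL⟩ := Finset.mem_filter.1 hq'
      rw [if_pos (by rw [dist_comm]; exact lt_of_not_ge hqL), dist_comm]
    generalize hF : (1024 / ((23 / 25 : ℝ) ^ 3 * L ^ 5)) = F₈ at hfar
    have hF0 : 0 ≤ F₈ := by rw [← hF]; positivity
    -- split the four products
    have hsplit : ∑ p ∈ B, ∑ q ∈ (SR.erase p).filter (fun q => ¬ dist p q ≤ L),
        (dist p q)⁻¹ ^ 8 * ((‖vt p‖ * ‖w p‖ + ‖vt q‖ * ‖w q‖) + (‖w p‖ * ‖vt q‖ + ‖vt p‖ * ‖w q‖)) =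
        (∑ p ∈ B, (‖vt p‖ * ‖w p‖) * ∑ q ∈ (SR.erase p).filter (fun q => ¬ dist p q ≤ L), (dist p q)⁻¹ ^ 8 +
          ∑ p ∈ B, ∑ q ∈ (SR.erase p).filter (fun q => ¬ dist p q ≤ L), (dist p q)⁻¹ ^ 8 * (‖vt q‖ * ‖w q‖)) +
        (∑ p ∈ B, ‖w p‖ * ∑ q ∈ (SR.erase p).filter (fun q => ¬ dist p q ≤ L), (dist p q)⁻¹ ^ 8 * ‖vt q‖ +
          ∑ p ∈ B, ‖vt p‖ * ∑ q ∈ (SR.erase p).filter (fun q => ¬ dist p q ≤ L), (dist p q)⁻¹ ^ 8 * ‖w q‖) := by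
      rw [← Finset.sum_add_distrib, ← Finset.sum_add_distrib, ← Finset.sum_add_distrib]
      refine Finset.sum_congr rfl fun p _ => ?_
      rw [Finset.mul_sum, Finset.mul_sum, Finset.mul_sum, ← Finset.sum_add_distrib, ← Finset.sum_add_distrib,
        ← Finset.sum_add_distrib]
      refine Finset.sum_congr rfl fun q _ => ?_
      ring
    rw [hsplit]
    -- the generic swap: a column-weighted far sum over the rows of `B` is a row sum seen from the column
    have hswap : ∀ (g : (EuclideanSpace ℝ (Fin 3)) → ℝ), (∀ x, 0 ≤ g x) → (∀ x, x ∉ B → g x = 0) →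
        ∑ p ∈ B, ∑ q ∈ (SR.erase p).filter (fun q => ¬ dist p q ≤ L), (dist p q)⁻¹ ^ 8 * g q ≤
          ∑ q ∈ B, g q * ∑ p ∈ (SR.erase q).filter (fun p => ¬ dist q p ≤ L), (dist q p)⁻¹ ^ 8 := by
      intro g hg0 hgB
      calc _ ≤ ∑ p ∈ SR, ∑ q ∈ SR.erase p, (if ¬ dist p q ≤ L then (dist p q)⁻¹ ^ 8 * g q else 0) := by
            refine le_trans (Finset.sum_le_sum fun p _ => ?_)
              (Finset.sum_le_sum_of_subset_of_nonneg hBT fun p _ _ => Finset.sum_nonneg fun q _ => by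
                split_ifs <;> [exact le_rfl; exact mul_nonneg (by positivity) (hg0 q)])
            rw [Finset.sum_filter]
        _ = ∑ q ∈ SR, ∑ p ∈ SR.erase q, (if ¬ dist p q ≤ L then (dist p q)⁻¹ ^ 8 * g q else 0) :=
            sum_sum_erase_comm SR _
        _ = ∑ q ∈ SR, g q * ∑ p ∈ (SR.erase q).filter (fun p => ¬ dist q p ≤ L), (dist q p)⁻¹ ^ 8 := by
            refine Finset.sum_congr rfl fun q _ => ?_
            rw [Finset.mul_sum, Finset.sum_filter]
            refine Finset.sum_congr rfl fun p _ => ?_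
            rw [dist_comm p q]
            split_ifs <;> ring
        _ = ∑ q ∈ B, g q * ∑ p ∈ (SR.erase q).filter (fun p => ¬ dist q p ≤ L), (dist q p)⁻¹ ^ 8 := by
            symm
            refine Finset.sum_subset hBT fun q _ hqB => ?_
            rw [hgB q hqB, zero_mul]
    -- currencies
    have hBmem : ∀ p ∈ B, p ∈ SR ∧ dist p c₀ ≤ ρ' := fun p hp => by rw [hB, Finset.mem_filter] at hp; exact hp
    have hW2B : ∑ x ∈ B, ‖w x‖ ^ 2 = ∑ x ∈ SR, ‖w x‖ ^ 2 := by
      refine Finset.sum_subset hBT fun x _ hxB => ?_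
      rw [hwB' x hxB, norm_zero]; ring
    have hCSB : ∑ p ∈ B, ‖vt p‖ * ‖w p‖ ≤ Real.sqrt (∑ x ∈ B, ‖vt x‖ ^ 2) * Real.sqrt (∑ x ∈ SR, ‖w x‖ ^ 2) := by
      rw [← hW2B]; exact sum_mul_le_sqrt_mul_sqrt B _ _
    have hsqrt0 : 0 ≤ Real.sqrt (∑ x ∈ B, ‖vt x‖ ^ 2) * Real.sqrt (∑ x ∈ SR, ‖w x‖ ^ 2) := by positivity
    -- T1 ≤ F₈ Σ_B ‖vt‖‖w‖
    have hT1 : ∑ p ∈ B, (‖vt p‖ * ‖w p‖) * ∑ q ∈ (SR.erase p).filter (fun q => ¬ dist p q ≤ L), (dist p q)⁻¹ ^ 8 ≤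
        F₈ * (Real.sqrt (∑ x ∈ B, ‖vt x‖ ^ 2) * Real.sqrt (∑ x ∈ SR, ‖w x‖ ^ 2)) := by
      calc _ ≤ ∑ p ∈ B, (‖vt p‖ * ‖w p‖) * F₈ :=
            Finset.sum_le_sum fun p hp => mul_le_mul_of_nonneg_left (hfar p (hBT hp)) (by positivity)
        _ = F₈ * ∑ p ∈ B, ‖vt p‖ * ‖w p‖ := by rw [Finset.mul_sum]; exact Finset.sum_congr rfl fun _ _ => mul_comm _ _
        _ ≤ _ := mul_le_mul_of_nonneg_left hCSB hF0
    -- T2 ≤ F₈ Σ_B ‖vt‖‖w‖ (swap)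
    have hT2 : ∑ p ∈ B, ∑ q ∈ (SR.erase p).filter (fun q => ¬ dist p q ≤ L), (dist p q)⁻¹ ^ 8 * (‖vt q‖ * ‖w q‖) ≤
        F₈ * (Real.sqrt (∑ x ∈ B, ‖vt x‖ ^ 2) * Real.sqrt (∑ x ∈ SR, ‖w x‖ ^ 2)) := by
      refine (hswap (fun q => ‖vt q‖ * ‖w q‖) (fun x => by positivity) (fun x hx => by rw [hwB' x hx]; simp)).trans ?_
      calc _ ≤ ∑ q ∈ B, (‖vt q‖ * ‖w q‖) * F₈ :=
            Finset.sum_le_sum fun q hq => mul_le_mul_of_nonneg_left (hfar q (hBT hq)) (by positivity)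
        _ = F₈ * ∑ q ∈ B, ‖vt q‖ * ‖w q‖ := by rw [Finset.mul_sum]; exact Finset.sum_congr rfl fun _ _ => mul_comm _ _
        _ ≤ _ := mul_le_mul_of_nonneg_left hCSB hF0
    -- T3 ≤ √(F₈ W2) √Θ₂ (Cauchy–Schwarz over the pairs)
    have hT3 : ∑ p ∈ B, ‖w p‖ * ∑ q ∈ (SR.erase p).filter (fun q => ¬ dist p q ≤ L), (dist p q)⁻¹ ^ 8 * ‖vt q‖ ≤
        Real.sqrt F₈ * Real.sqrt Θ₂ * Real.sqrt (∑ x ∈ SR, ‖w x‖ ^ 2) := by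
      have e1 : ∑ p ∈ B, ‖w p‖ * ∑ q ∈ (SR.erase p).filter (fun q => ¬ dist p q ≤ L), (dist p q)⁻¹ ^ 8 * ‖vt q‖ =
          ∑ p ∈ B, ∑ q ∈ (SR.erase p).filter (fun q => ¬ dist p q ≤ L), (dist p q)⁻¹ ^ 8 * ‖w p‖ * ‖vt q‖ := by
        refine Finset.sum_congr rfl fun p _ => ?_
        rw [Finset.mul_sum]
        exact Finset.sum_congr rfl fun q _ => by ring
      rw [e1]
      have hCS := sum_sum_weight_mul_le B (fun p => (SR.erase p).filter (fun q => ¬ dist p q ≤ L))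
        (ω := fun p q => (dist p q)⁻¹ ^ 8) (a := fun p _ => ‖w p‖) (b := fun _ q => ‖vt q‖)
        (fun p q => by positivity) (fun p q => norm_nonneg _) (fun p q => norm_nonneg _)
      refine hCS.trans ?_
      have h1 : ∑ p ∈ B, ∑ q ∈ (SR.erase p).filter (fun q => ¬ dist p q ≤ L), (dist p q)⁻¹ ^ 8 * ‖w p‖ ^ 2 ≤
          F₈ * ∑ x ∈ SR, ‖w x‖ ^ 2 := by
        calc _ = ∑ p ∈ B, ‖w p‖ ^ 2 * ∑ q ∈ (SR.erase p).filter (fun q => ¬ dist p q ≤ L), (dist p q)⁻¹ ^ 8 := by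
              refine Finset.sum_congr rfl fun p _ => ?_
              rw [Finset.mul_sum]; exact Finset.sum_congr rfl fun q _ => mul_comm _ _
          _ ≤ ∑ p ∈ B, ‖w p‖ ^ 2 * F₈ :=
              Finset.sum_le_sum fun p hp => mul_le_mul_of_nonneg_left (hfar p (hBT hp)) (sq_nonneg _)
          _ = F₈ * ∑ x ∈ B, ‖w x‖ ^ 2 := by rw [Finset.mul_sum]; exact Finset.sum_congr rfl fun _ _ => mul_comm _ _
          _ = F₈ * ∑ x ∈ SR, ‖w x‖ ^ 2 := by rw [hW2B]
      have h2 : ∑ p ∈ B, ∑ q ∈ (SR.erase p).filter (fun q => ¬ dist p q ≤ L), (dist p q)⁻¹ ^ 8 * ‖vt q‖ ^ 2 ≤ Θ₂ := by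
        rw [hB]; exact hΘ
      calc Real.sqrt (∑ p ∈ B, ∑ q ∈ (SR.erase p).filter (fun q => ¬ dist p q ≤ L), (dist p q)⁻¹ ^ 8 * ‖w p‖ ^ 2) *
            Real.sqrt (∑ p ∈ B, ∑ q ∈ (SR.erase p).filter (fun q => ¬ dist p q ≤ L), (dist p q)⁻¹ ^ 8 * ‖vt q‖ ^ 2)
          ≤ Real.sqrt (F₈ * ∑ x ∈ SR, ‖w x‖ ^ 2) * Real.sqrt Θ₂ :=
            mul_le_mul (Real.sqrt_le_sqrt h1) (Real.sqrt_le_sqrt h2) (Real.sqrt_nonneg _) (Real.sqrt_nonneg _)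
        _ = Real.sqrt F₈ * Real.sqrt Θ₂ * Real.sqrt (∑ x ∈ SR, ‖w x‖ ^ 2) := by rw [Real.sqrt_mul hF0]; ring
    -- T4 ≤ F₈ √E_B √W2 (Cauchy–Schwarz over the pairs, then swap)
    have hT4 : ∑ p ∈ B, ‖vt p‖ * ∑ q ∈ (SR.erase p).filter (fun q => ¬ dist p q ≤ L), (dist p q)⁻¹ ^ 8 * ‖w q‖ ≤
        F₈ * (Real.sqrt (∑ x ∈ B, ‖vt x‖ ^ 2) * Real.sqrt (∑ x ∈ SR, ‖w x‖ ^ 2)) := by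
      have e1 : ∑ p ∈ B, ‖vt p‖ * ∑ q ∈ (SR.erase p).filter (fun q => ¬ dist p q ≤ L), (dist p q)⁻¹ ^ 8 * ‖w q‖ =
          ∑ p ∈ B, ∑ q ∈ (SR.erase p).filter (fun q => ¬ dist p q ≤ L), (dist p q)⁻¹ ^ 8 * ‖vt p‖ * ‖w q‖ := by
        refine Finset.sum_congr rfl fun p _ => ?_
        rw [Finset.mul_sum]
        exact Finset.sum_congr rfl fun q _ => by ring
      rw [e1]
      have hCS := sum_sum_weight_mul_le B (fun p => (SR.erase p).filter (fun q => ¬ dist p q ≤ L))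
        (ω := fun p q => (dist p q)⁻¹ ^ 8) (a := fun p _ => ‖vt p‖) (b := fun _ q => ‖w q‖)
        (fun p q => by positivity) (fun p q => norm_nonneg _) (fun p q => norm_nonneg _)
      refine hCS.trans ?_
      have h1 : ∑ p ∈ B, ∑ q ∈ (SR.erase p).filter (fun q => ¬ dist p q ≤ L), (dist p q)⁻¹ ^ 8 * ‖vt p‖ ^ 2 ≤
          F₈ * ∑ x ∈ B, ‖vt x‖ ^ 2 := by
        calc _ = ∑ p ∈ B, ‖vt p‖ ^ 2 * ∑ q ∈ (SR.erase p).filter (fun q => ¬ dist p q ≤ L), (dist p q)⁻¹ ^ 8 := by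
              refine Finset.sum_congr rfl fun p _ => ?_
              rw [Finset.mul_sum]; exact Finset.sum_congr rfl fun q _ => mul_comm _ _
          _ ≤ ∑ p ∈ B, ‖vt p‖ ^ 2 * F₈ :=
              Finset.sum_le_sum fun p hp => mul_le_mul_of_nonneg_left (hfar p (hBT hp)) (sq_nonneg _)
          _ = F₈ * ∑ x ∈ B, ‖vt x‖ ^ 2 := by rw [Finset.mul_sum]; exact Finset.sum_congr rfl fun _ _ => mul_comm _ _
      have h2 : ∑ p ∈ B, ∑ q ∈ (SR.erase p).filter (fun q => ¬ dist p q ≤ L), (dist p q)⁻¹ ^ 8 * ‖w q‖ ^ 2 ≤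
          F₈ * ∑ x ∈ SR, ‖w x‖ ^ 2 := by
        refine (hswap (fun q => ‖w q‖ ^ 2) (fun x => sq_nonneg _) (fun x hx => by rw [hwB' x hx, norm_zero]; ring)).trans ?_
        calc _ ≤ ∑ q ∈ B, ‖w q‖ ^ 2 * F₈ :=
              Finset.sum_le_sum fun q hq => mul_le_mul_of_nonneg_left (hfar q (hBT hq)) (sq_nonneg _)
          _ = F₈ * ∑ x ∈ B, ‖w x‖ ^ 2 := by rw [Finset.mul_sum]; exact Finset.sum_congr rfl fun _ _ => mul_comm _ _
          _ = F₈ * ∑ x ∈ SR, ‖w x‖ ^ 2 := by rw [hW2B]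
      calc Real.sqrt (∑ p ∈ B, ∑ q ∈ (SR.erase p).filter (fun q => ¬ dist p q ≤ L), (dist p q)⁻¹ ^ 8 * ‖vt p‖ ^ 2) *
            Real.sqrt (∑ p ∈ B, ∑ q ∈ (SR.erase p).filter (fun q => ¬ dist p q ≤ L), (dist p q)⁻¹ ^ 8 * ‖w q‖ ^ 2)
          ≤ Real.sqrt (F₈ * ∑ x ∈ B, ‖vt x‖ ^ 2) * Real.sqrt (F₈ * ∑ x ∈ SR, ‖w x‖ ^ 2) :=
            mul_le_mul (Real.sqrt_le_sqrt h1) (Real.sqrt_le_sqrt h2) (Real.sqrt_nonneg _) (Real.sqrt_nonneg _)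
        _ = F₈ * (Real.sqrt (∑ x ∈ B, ‖vt x‖ ^ 2) * Real.sqrt (∑ x ∈ SR, ‖w x‖ ^ 2)) := by
            rw [Real.sqrt_mul hF0, Real.sqrt_mul hF0]
            have := Real.mul_self_sqrt hF0
            calc Real.sqrt F₈ * Real.sqrt (∑ x ∈ B, ‖vt x‖ ^ 2) * (Real.sqrt F₈ * Real.sqrt (∑ x ∈ SR, ‖w x‖ ^ 2))
                = (Real.sqrt F₈ * Real.sqrt F₈) * (Real.sqrt (∑ x ∈ B, ‖vt x‖ ^ 2) * Real.sqrt (∑ x ∈ SR, ‖w x‖ ^ 2)) := by ring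
              _ = _ := by rw [this]
    nlinarith [hT1, hT2, hT3, hT4, hsqrt0, Real.sqrt_nonneg F₈, Real.sqrt_nonneg Θ₂,
      Real.sqrt_nonneg (∑ x ∈ SR, ‖w x‖ ^ 2)]

end

end Summit.AtomisticToContinuum.Crystallization.Theorems.ExcessDecayLiouville

end
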